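/-
Literature anchor (engines group, cap lane, anchor #34): a kernel-checkable certificate for one
validated integration step of a polynomial initial value problem with rational data — Moore's
Taylor-coefficient recursion carried out on sparse rational polynomials, natural interval
extension over the initial and the a-priori box, and the high-order-enclosure inclusion test of
Moore 1979 §8.1 / Nedialkov–Jackson–Pryce 2001 §3, with a Boolean checker whose acceptance
implies existence of the solution on the step and its enclosure (soundness =
`highOrderEnclosure_step_intervalTest`); Moore's Volterra example (1979, §8.1 (8.6)) is replayed
by `decide` in the kernel.
-/
import Literature.Analysis.ODE.HighOrderEnclosureIntervalTest
import Literature.Analysis.ValidatedNumerics.SparsePolynomialEnclosure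
import Literature.Analysis.ValidatedNumerics.Certificate
import HarnessLib

/-!
# A kernel-checkable high-order enclosure step certificate

Trunk T-ANA (Analysis/ODE); namespace `Literature.Analysis.ODE`.

`HighOrderEnclosureIntervalTest.lean` proves the **HOE existence test in interval form**
(`highOrderEnclosure_step_intervalTest`): for `y' = p(y)` with `p` polynomial, boxes
`Eⱼ ⊇ Φⱼ(W)` (`j < K`) and `V ⊇ Φ_K(S)` enclosing the Taylor coefficient maps and the containment
`∑_{j<K} [0,h]ʲ · Eⱼ + [0,h]^K · V ⊆ S` give existence on `[0, h]` from every `y₀ ∈ W` and the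
enclosure of every solution in `S` and in the Taylor tube (Moore 1979 §8.1 (8.10), (8.13);
Nedialkov–Jackson–Pryce 2001 §3).  Its hypotheses are statements about *real* interval vectors.
This file makes the test **executable and checkable by the Lean kernel** when the data are
rational: the field `p` is a vector of sparse rational polynomials (`QMvPoly`,
`SparsePolynomialEnclosure.lean`), the Taylor coefficient polynomials are generated by Moore's
recursion `(x)_{k+1} = (1/(k+1)) L_p (x)_k` in exact rational arithmetic (`taylorQ`, proved equal
to `taylorPoly` under `QMvPoly.toMv`), the boxes `Eⱼ`, `V` are their natural interval extensions
over `W` and `S` (`QMvPoly.enclVec`, sound by Moore's Corollary 3.1 = `QMvPoly.eval_toMv_mem_encl`),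
and the inclusion test is a decidable comparison of rational interval vectors.

## Contents

* `lieDerQ`, `taylorQ` — the Lie derivative `L_P q = ∑ᵢ Pᵢ ∂ᵢ q` and the Taylor coefficient
  recursion on term lists, with `toMv_lieDerQ`, `toMv_taylorQ` (agreement with `lieDerivation`,
  `taylorPoly` of `LieSeriesTaylorCoefficients.lean` in any field of characteristic zero).
* `castBox`, `fieldMv`, `mapsTo_taylorMap_enclVec` — the real semantics: the Taylor coefficient
  maps `taylorMap (fieldMv P) k` send the real box of `B` into the real box of
  `enclVec B (taylorQ P k)` (hypotheses `hE`, `hV` of the interval test).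
* `hoeBoxQ` (+ `castBox_hoeBoxQ : castBox (hoeBoxQ T E V K) = hoeBox …`), `boxLE`
  (+ `le_of_boxLE`), `stepIv` — the rational HOE box `∑_{j<K} Tʲ·Eⱼ + T^K·V`, the decidable
  containment of interval vectors, the step interval `[0, h]`.
* `HOEStepCert n` — the certificate: field, order `K`, step `h`, initial box `W`, a-priori box
  `S`; `HOEStepCert.check : Bool` (the HOE test (8.10) ⊆ `S` with `T = [0, h]`) and
  **`HOEStepCert.sound`**: `check = true` ⇒ existence on `[0, h]` from every `y₀ ∈ W` and
  enclosure of every solution in `S` and in the Taylor tube with remainder box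
  `remBox = enclVec S (taylorQ field K)`; `HOEStepCert.endBox` / `mem_endBox` — the tight box at
  `t = h` (Moore (8.10) at `t₁`); `hoeStepVerifier` — the same packaged as a
  `ValidatedNumerics.Verifier` (instance = field, order, step, initial box; certificate = the
  a-priori box found by any untrusted search; checker = `check`).
* **Moore's example replayed in the kernel** (`mooreVolterra`): Volterra's equations
  `x₁' = 2x₁(1 − x₂)`, `x₂' = −x₂(1 − x₁)`, `x(0) = (1, 3)`, a-priori box
  `B = [0, 4/3] × [2.5, 19/6]`, step `h = 0.125` (Moore 1979 §8.1 (8.6)–(8.8)): `decide` accepts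
  the order-9 certificate, whence (theorems `mooreVolterra_exists`, `mooreVolterra_endpoint`)
  the solution exists on `[0, 0.125]`, stays in `B`, and `x(0.125)` lies in the certified end box,
  in particular `x₂(0.125) ∈ [2.92126, 2.92192]` — consistent with (and, because the natural
  extension is taken in expanded monomial form rather than through the recursion (8.9), coarser
  than) Moore's `N = 9` row `[2.9215249, 2.9215965]` of the table on p. 82.

Everything computable is exact rational arithmetic (Moore 1966 §4.4: with rational endpoints the
machine interval arithmetic can be carried out exactly); outward rounding (`roundOut`) may be
inserted in front of any box by inclusion monotonicity (`QMvPoly.encl_mono`,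
`hoeBox_le_hoeBox`) but is not needed for kernel replay.  No facts, no axioms, no `sorry`.

## References

* R. E. Moore, *Methods and Applications of Interval Analysis*, SIAM 1979: §3.3 Corollary 3.1,
  §3.4 (3.13)–(3.18) (Taylor coefficient recursion), §3.5 (3.31), §8.1 (8.5)–(8.13) and the table
  on p. 82 (Volterra example). [held: lit key book:moorend-methods-applications-interval-analysis,
  pp. 23–27, 80–83]
* N. S. Nedialkov, K. R. Jackson, J. D. Pryce, *An effective high-order interval method for
  validating existence and uniqueness of the solution of an IVP for an ODE*, Reliable Computing 7
  (2001), §3 (the HOE existence test).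
* N. S. Nedialkov, K. R. Jackson, G. F. Corliss, *Validated solutions of initial value problems
  for ordinary differential equations*, Appl. Math. Comput. 105 (1999), §5 Algorithm I.
* E. Hairer, C. Lubich, G. Wanner, *Geometric Numerical Integration*, Springer 2002, §III.5.1
  eq. (5.2)–(5.3), Lemma 5.1 (Lie derivative and Lie series of the flow).
* R. E. Moore, *Interval Analysis*, Prentice-Hall 1966, §4.4 (exact rational interval arithmetic
  as the machine model of a checker).
-/

open Set NonemptyInterval
open Literature.Analysis.ValidatedNumerics

namespace Literature.Analysis.ODE

/-! ### Moore's Taylor coefficient recursion on term lists -/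

section TermLists

variable {n : ℕ}

/-- The **Lie derivative on term lists**: `L_P q = ∑ᵢ Pᵢ · ∂ᵢ q`, computed by exact polynomial
arithmetic and merged (`QMvPoly.normalize`). [cite: HairerWannerLubich2002, §III.5.1 eq. (5.2)]
[cite: Moore1979, §3.4 eqs. (3.17)–(3.18)] -/
def lieDerQ (P : Fin n → QMvPoly) (q : QMvPoly) : QMvPoly :=
  QMvPoly.normalize
    ((List.finRange n).map fun i => QMvPoly.mul (P i) (QMvPoly.pderivQ i q)).flatten

/-- `lieDerQ` computes the Lie derivation `lieDerivation` of `LieSeriesTaylorCoefficients.lean`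
under the semantics `QMvPoly.toMv`. [cite: HairerWannerLubich2002, §III.5.1 eq. (5.2)] -/
theorem toMv_lieDerQ (R : Type*) [Field R] [CharZero R] (P : Fin n → QMvPoly) (q : QMvPoly) :
    QMvPoly.toMv R n (lieDerQ P q) =
      lieDerivation (fun i => QMvPoly.toMv R n (P i)) (QMvPoly.toMv R n q) := by
  rw [lieDerQ, QMvPoly.toMv_normalize, QMvPoly.toMv_flatten, lieDerivation_apply,
    Fin.sum_univ_def, List.map_map]
  congr 1
  refine List.map_congr_left fun i _ => ?_
  simp only [Function.comp_apply, QMvPoly.toMv_mul, QMvPoly.toMv_pderivQ]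

/-- **Moore's recursion for the Taylor coefficient polynomials, on term lists**:
`(x)₀ = xᵢ`, `(x)_{k+1} = (1/(k+1)) · L_P (x)_k` (Moore 1979 §3.4 (3.13)–(3.17), §8.1 (8.9)),
in exact rational arithmetic. [cite: Moore1979, §3.4 eqs. (3.13)–(3.17) and §8.1 eq. (8.9)] -/
def taylorQ (P : Fin n → QMvPoly) : ℕ → Fin n → QMvPoly
  | 0 => fun i => QMvPoly.var n i
  | k + 1 => fun i => QMvPoly.smul (1 / ((k : ℚ) + 1)) (lieDerQ P (taylorQ P k i))

/-- `taylorQ` computes the Taylor coefficient polynomials `taylorPoly p k i = (k!)⁻¹ L_pᵏ Xᵢ`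
of the flow (`LieSeriesTaylorCoefficients.lean`) under the semantics `QMvPoly.toMv`.
[cite: Moore1979, §3.4 eqs. (3.13)–(3.17)] [cite: HairerWannerLubich2002, §III.5.1 eq. (5.3)] -/
theorem toMv_taylorQ (R : Type*) [Field R] [CharZero R] (P : Fin n → QMvPoly) (k : ℕ)
    (i : Fin n) :
    QMvPoly.toMv R n (taylorQ P k i) = taylorPoly (fun i => QMvPoly.toMv R n (P i)) k i := by
  induction k with
  | zero => simp only [taylorQ, taylorPoly_zero, QMvPoly.toMv_var]
  | succ k ih =>
      simp only [taylorQ]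
      rw [QMvPoly.toMv_smul, toMv_lieDerQ, ih, lieDerivation_taylorPoly,
        ← Nat.cast_smul_eq_nsmul R, smul_smul]
      have h1 : (((1 / ((k : ℚ) + 1) : ℚ) : R) * ((k + 1 : ℕ) : R)) = 1 := by
        have hk : ((k : R) + 1) ≠ 0 := Nat.cast_add_one_ne_zero k
        push_cast
        rw [one_div, inv_mul_cancel₀ hk]
      rw [h1, one_smul]

end TermLists

/-! ### Real semantics of rational boxes and fields -/

section RealSemantics

variable {n : ℕ}

/-- The real interval vector represented by a vector of rational intervals (Moore 1979 §2.1).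
[cite: Moore1979, §2.1] -/
noncomputable def castBox (B : Fin n → NonemptyInterval ℚ) : Fin n → NonemptyInterval ℝ :=
  fun i => (B i).ratCast ℝ

/-- Components of `castBox`. [cite: Moore1979, §2.1] -/
@[simp] theorem castBox_apply (B : Fin n → NonemptyInterval ℚ) (i : Fin n) :
    castBox B i = (B i).ratCast ℝ := rfl

/-- `castBox` is inclusion monotonic. [cite: Moore1979, §3.2 eqs. (3.4)–(3.5)] -/
theorem castBox_mono {A B : Fin n → NonemptyInterval ℚ} (h : A ≤ B) : castBox A ≤ castBox B :=
  fun i => ratCast_mono (h i)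

/-- The real polynomial vector field represented by a vector of term lists (the right-hand side
`f(y)` of `ẏ = f(y)`). [cite: HairerWannerLubich2002, §III.5.1 eq. (5.1)] -/
noncomputable def fieldMv (P : Fin n → QMvPoly) : Fin n → MvPolynomial (Fin n) ℝ :=
  fun i => QMvPoly.toMv ℝ n (P i)

/-- The Taylor coefficient maps of the represented field are the evaluations of the term lists
`taylorQ P k`. [cite: Moore1979, §3.4 eqs. (3.13)–(3.17)] -/
theorem taylorMap_fieldMv_apply (P : Fin n → QMvPoly) (k : ℕ) (x : Fin n → ℝ) (i : Fin n) :
    taylorMap (fieldMv P) k x i = MvPolynomial.eval x (QMvPoly.toMv ℝ n (taylorQ P k i)) := by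
  simp only [taylorMap, evalVec_apply]
  rw [toMv_taylorQ]
  rfl

/-- **The enclosures `Eⱼ`, `V` of the HOE test, computed and sound**: the Taylor coefficient map
`Φₖ` of the represented field sends the real box of `B` into the real box of the natural interval
extension `enclVec B (taylorQ P k)` (Moore 1979 Corollary 3.1 applied to (8.9)–(8.10)).
[cite: Moore1979, §3.3 Corollary 3.1 and §8.1 eqs. (8.9)–(8.10)] -/
theorem mapsTo_taylorMap_enclVec (P : Fin n → QMvPoly) (k : ℕ) (B : Fin n → NonemptyInterval ℚ) :
    MapsTo (taylorMap (fieldMv P) k) (boxSet (castBox B))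
      (boxSet (castBox (QMvPoly.enclVec B (taylorQ P k)))) := by
  intro x hx
  rw [mem_boxSet_iff] at hx ⊢
  intro i
  rw [taylorMap_fieldMv_apply]
  exact QMvPoly.eval_toMv_mem_encl hx (taylorQ P k i)

end RealSemantics

/-! ### The rational HOE box and the decidable inclusion test -/

section Test

variable {n : ℕ}

/-- Partial sums `∑_{j<m} Tʲ · Eⱼ(i)` of the rational HOE box (structural recursion, so that the
kernel can evaluate it). [cite: Moore1979, §3.5 eq. (3.31) and §8.1 eq. (8.10)] -/
def hoeSumQ (T : NonemptyInterval ℚ) (E : ℕ → Fin n → NonemptyInterval ℚ) (i : Fin n) :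
    ℕ → NonemptyInterval ℚ
  | 0 => 0
  | m + 1 => hoeSumQ T E i m + (T.moorePow m).mooreMul (E m i)

/-- The **rational HOE box** `∑_{j<K} Tʲ · Eⱼ + T^K · V` — Moore's interval polynomial
`X^{(N)}(T)` of (8.10), the left-hand side of the HOE inclusion test, in exact rational interval
arithmetic. [cite: Moore1979, §8.1 eq. (8.10)] [cite: NedialkovJacksonPryce2001, §3 (HOE existence test)] -/
def hoeBoxQ (T : NonemptyInterval ℚ) (E : ℕ → Fin n → NonemptyInterval ℚ)
    (V : Fin n → NonemptyInterval ℚ) (K : ℕ) : Fin n → NonemptyInterval ℚ :=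
  fun i => hoeSumQ T E i K + (T.moorePow K).mooreMul (V i)

/-- Casting the partial sums. [cite: Moore1979, §8.1 eq. (8.10)] -/
theorem ratCast_hoeSumQ (T : NonemptyInterval ℚ) (E : ℕ → Fin n → NonemptyInterval ℚ) (i : Fin n)
    (m : ℕ) : (hoeSumQ T E i m).ratCast ℝ =
      ∑ j ∈ Finset.range m, ((T.ratCast ℝ).moorePow j).mooreMul ((E j i).ratCast ℝ) := by
  induction m with
  | zero => simp only [hoeSumQ, Finset.range_zero, Finset.sum_empty, QMvPoly.ratCast_zero]
  | succ m ih =>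
      rw [hoeSumQ, QMvPoly.ratCast_add, ih, Finset.sum_range_succ, ratCast_mooreMul,
        ratCast_moorePow]

/-- **The rational HOE box represents the real one**: `castBox (hoeBoxQ T E V K)` is the
`hoeBox` of `HighOrderEnclosureIntervalTest.lean` of the cast data.
[cite: Moore1979, §8.1 eq. (8.10)] -/
theorem castBox_hoeBoxQ (T : NonemptyInterval ℚ) (E : ℕ → Fin n → NonemptyInterval ℚ)
    (V : Fin n → NonemptyInterval ℚ) (K : ℕ) :
    castBox (hoeBoxQ T E V K) = hoeBox (T.ratCast ℝ) (fun j => castBox (E j)) (castBox V) K := by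
  funext i
  simp only [castBox, hoeBoxQ, hoeBox]
  rw [QMvPoly.ratCast_add, ratCast_hoeSumQ, ratCast_mooreMul, ratCast_moorePow]

/-- **Decidable containment of rational interval vectors** `A ⊆ B` (componentwise
`Bᵢ.lo ≤ Aᵢ.lo ∧ Aᵢ.hi ≤ Bᵢ.hi`) — the comparison in the HOE test (8.10) ⊆ B.
[cite: Moore1979, §8.1 eqs. (8.5), (8.10)] -/
def boxLE (A B : Fin n → NonemptyInterval ℚ) : Bool :=
  (List.finRange n).all fun i => decide (A i ≤ B i)

/-- `boxLE A B = true` means `A ≤ B` componentwise. [cite: Moore1979, §8.1 eqs. (8.5), (8.10)] -/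
theorem le_of_boxLE {A B : Fin n → NonemptyInterval ℚ} (h : boxLE A B = true) : A ≤ B :=
  fun i => of_decide_eq_true (List.all_eq_true.1 h i (List.mem_finRange i))

/-- The rational step interval `[0, h]` (as `[min 0 h, max 0 h]`, total in `h`).
[cite: Moore1979, §8.1 eq. (8.10)] -/
def stepIv (h : ℚ) : NonemptyInterval ℚ :=
  ⟨(min 0 h, max 0 h), min_le_max⟩

/-- `[0, h] ⊆ stepIv h` after casting to `ℝ` (hypothesis `hT` of the interval test).
[cite: Moore1979, §8.1 eq. (8.10)] -/
theorem mem_ratCast_stepIv {h : ℚ} {t : ℝ} (ht : t ∈ Icc (0 : ℝ) (h : ℝ)) :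
    t ∈ (stepIv h).ratCast ℝ := by
  rw [mem_ratCast_iff]
  refine ⟨le_trans ?_ ht.1, le_trans ht.2 ?_⟩
  · exact_mod_cast min_le_left (0 : ℚ) h
  · exact_mod_cast le_max_right (0 : ℚ) h

end Test

/-! ### The certificate and its soundness -/

/-- A **high-order enclosure step certificate** for a polynomial initial value problem with
rational data: the field `y' = P(y)` as term lists, the order `K`, the step `h`, the initial box
`W` and the claimed a-priori enclosure `S ⊇ y([0, h])` (Moore's constant box `B` of (8.5)/(8.13),
the box found by the untrusted stage of NJP's Algorithm I).
[cite: Moore1979, §8.1 eqs. (8.5), (8.10), (8.13)] [cite: NedialkovJacksonCorliss1999, §5 Algorithm I] -/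
structure HOEStepCert (n : ℕ) where
  /-- The polynomial vector field, one term list per component. -/
  field : Fin n → QMvPoly
  /-- The order `K ≥ 1` of the Taylor expansion (remainder term of degree `K`). -/
  order : ℕ
  /-- The step size `h ≥ 0`. -/
  step : ℚ
  /-- The box `W` of initial values. -/
  init : Fin n → NonemptyInterval ℚ
  /-- The claimed a-priori enclosure `S` of the solution over the whole step. -/
  apriori : Fin n → NonemptyInterval ℚ

namespace HOEStepCert

variable {n : ℕ} (c : HOEStepCert n)

/-- The coefficient boxes `Eⱼ = enclVec W (x)ⱼ` (natural interval extension of the `j`-th Taylor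
coefficient polynomials over the initial box). [cite: Moore1979, §8.1 eqs. (8.9)–(8.10)] -/
def coeffBox (j : ℕ) : Fin n → NonemptyInterval ℚ :=
  QMvPoly.enclVec c.init (taylorQ c.field j)

/-- The remainder box `V = R^{(K)} = enclVec S (x)_K` (natural interval extension of the `K`-th
Taylor coefficient polynomials over the a-priori box). [cite: Moore1979, §8.1 eqs. (8.9)–(8.12)] -/
def remBox : Fin n → NonemptyInterval ℚ :=
  QMvPoly.enclVec c.apriori (taylorQ c.field c.order)

/-- **The checker**: `K ≥ 1`, `h ≥ 0`, and the HOE inclusion test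
`∑_{j<K} [0,h]ʲ · Eⱼ + [0,h]^K · V ⊆ S` in exact rational interval arithmetic.
[cite: Moore1979, §8.1 eq. (8.10) with (8.13)] [cite: NedialkovJacksonPryce2001, §3 (HOE existence test)] -/
def check : Bool :=
  decide (0 < c.order) && decide (0 ≤ c.step) &&
    boxLE (hoeBoxQ (stepIv c.step) c.coeffBox c.remBox c.order) c.apriori

/-- The **end box** `∑_{j<K} [h,h]ʲ · Eⱼ + [h,h]^K · V ∋ y(h)` (Moore (8.10) at `t = t₁`; the
initial box of the next step). [cite: Moore1979, §8.1 eq. (8.10)]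
[cite: NedialkovJacksonCorliss1999, §5 Algorithm I] -/
def endBox : Fin n → NonemptyInterval ℚ :=
  hoeBoxQ (pure c.step) c.coeffBox c.remBox c.order

variable {c}

/-- What an accepted certificate establishes about the real data: `0 < K`, `0 ≤ h`, and the real
HOE test `hoeBox [0,h] E V K ≤ S`. [cite: Moore1979, §8.1 eq. (8.10)] -/
theorem check_spec (hc : c.check = true) :
    0 < c.order ∧ (0 : ℝ) ≤ (c.step : ℝ) ∧
      hoeBox ((stepIv c.step).ratCast ℝ) (fun j => castBox (c.coeffBox j)) (castBox c.remBox)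
        c.order ≤ castBox c.apriori := by
  simp only [check, Bool.and_eq_true, decide_eq_true_eq] at hc
  refine ⟨hc.1.1, by exact_mod_cast hc.1.2, ?_⟩
  have htest := castBox_mono (le_of_boxLE hc.2)
  rw [castBox_hoeBoxQ] at htest
  exact htest

/-- **Soundness of the HOE step certificate.**  If `check` accepts, then for every real initial
value `y₀` in the box `W`: a solution of `y' = P(y)`, `y(0) = y₀` exists on `[0, h]`, and every
solution `z` from `y₀` stays in the a-priori box `S` and in the Taylor tube
`∑_{j<K} tʲ Φⱼ(y₀) + t^K · V` for all `t ∈ [0, h]` (Moore 1979 §8.1 (8.10), (8.13);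
Nedialkov–Jackson–Pryce 2001 §3) — `highOrderEnclosure_step_intervalTest` with all its box
hypotheses discharged by computation. [cite: NedialkovJacksonPryce2001, §3 (HOE existence test)]
[cite: Moore1979, §8.1 eqs. (8.10), (8.13)] -/
theorem sound (hc : c.check = true) {y₀ : Fin n → ℝ} (hy₀ : y₀ ∈ boxSet (castBox c.init)) :
    (∃ y : ℝ → Fin n → ℝ, y 0 = y₀ ∧
        ∀ t ∈ Icc 0 (c.step : ℝ),
          HasDerivWithinAt y (evalVec (fieldMv c.field) (y t)) (Icc 0 (c.step : ℝ)) t) ∧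
      ∀ z : ℝ → Fin n → ℝ, z 0 = y₀ →
        (∀ t ∈ Icc 0 (c.step : ℝ),
            HasDerivWithinAt z (evalVec (fieldMv c.field) (z t)) (Icc 0 (c.step : ℝ)) t) →
          ∀ t ∈ Icc 0 (c.step : ℝ), z t ∈ boxSet (castBox c.apriori) ∧
            ∃ v ∈ boxSet (castBox c.remBox),
              z t = (∑ j ∈ Finset.range c.order, t ^ j • taylorMap (fieldMv c.field) j y₀) +
                t ^ c.order • v := by
  obtain ⟨hK, hh, htest⟩ := check_spec hc
  exact highOrderEnclosure_step_intervalTest (fieldMv c.field) hK hh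
    (fun t ht => mem_ratCast_stepIv ht) (castBox c.init) (castBox c.apriori) (castBox c.remBox)
    (fun j => castBox (c.coeffBox j)) (fun j _ => mapsTo_taylorMap_enclVec c.field j c.init)
    (mapsTo_taylorMap_enclVec c.field c.order c.apriori) htest hy₀

/-- **The certified end box**: if `check` accepts, every solution from `y₀ ∈ W` satisfies
`z(h) ∈ endBox` (Moore (8.10) at `t₁`; the hand-over to the next step of Algorithm I).
[cite: Moore1979, §8.1 eq. (8.10)] [cite: NedialkovJacksonCorliss1999, §5 Algorithm I] -/
theorem mem_endBox (hc : c.check = true) {y₀ : Fin n → ℝ} (hy₀ : y₀ ∈ boxSet (castBox c.init))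
    {z : ℝ → Fin n → ℝ} (hz0 : z 0 = y₀)
    (hz : ∀ t ∈ Icc 0 (c.step : ℝ),
      HasDerivWithinAt z (evalVec (fieldMv c.field) (z t)) (Icc 0 (c.step : ℝ)) t) :
    z c.step ∈ boxSet (castBox c.endBox) := by
  obtain ⟨hK, hh, htest⟩ := check_spec hc
  have h := highOrderEnclosure_endpoint (fieldMv c.field) hK hh
    (fun t ht => mem_ratCast_stepIv ht) (castBox c.init) (castBox c.apriori) (castBox c.remBox)
    (fun j => castBox (c.coeffBox j)) (fun j _ => mapsTo_taylorMap_enclVec c.field j c.init)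
    (mapsTo_taylorMap_enclVec c.field c.order c.apriori) htest hy₀ hz0 hz
  rw [endBox, castBox_hoeBoxQ, ratCast_pure]
  exact h

end HOEStepCert

/-! ### The certificate as a `Verifier` -/

section VerifierPackaging

variable {n : ℕ}

/-- An **HOE step instance**: the data fixed in advance (field, order, step, initial box); the
a-priori box is the certificate to be searched for by an untrusted stage (NJC 1999 Algorithm I:
"guess" `S`, then validate). [cite: NedialkovJacksonCorliss1999, §5 Algorithm I] -/
structure HOEInstance (n : ℕ) where
  /-- The polynomial vector field. -/
  field : Fin n → QMvPoly
  /-- The order `K`. -/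
  order : ℕ
  /-- The step size `h`. -/
  step : ℚ
  /-- The initial box `W`. -/
  init : Fin n → NonemptyInterval ℚ

/-- The claim certified for an instance: existence of a solution on `[0, h]` from every initial
value in `W`. [cite: NedialkovJacksonPryce2001, §3 (HOE existence test)] -/
def HOEInstance.Claim (I : HOEInstance n) : Prop :=
  ∀ y₀ ∈ boxSet (castBox I.init), ∃ y : ℝ → Fin n → ℝ, y 0 = y₀ ∧
    ∀ t ∈ Icc 0 (I.step : ℝ),
      HasDerivWithinAt y (evalVec (fieldMv I.field) (y t)) (Icc 0 (I.step : ℝ)) t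

/-- The instance together with a candidate a-priori box, as a certificate.
[cite: NedialkovJacksonCorliss1999, §5 Algorithm I] -/
def HOEInstance.withBox (I : HOEInstance n) (S : Fin n → NonemptyInterval ℚ) : HOEStepCert n :=
  ⟨I.field, I.order, I.step, I.init, S⟩

/-- **The HOE step verifier** in the sense of `ValidatedNumerics.Verifier`: certificates are
a-priori boxes, the checker is `HOEStepCert.check`, soundness is `HOEStepCert.sound`.
[cite: NedialkovJacksonPryce2001, §3 (HOE existence test)] [cite: Moore1979, §8.1 eq. (8.10)] -/
def hoeStepVerifier (n : ℕ) : Verifier (HOEInstance n) HOEInstance.Claim where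
  Cert := Fin n → NonemptyInterval ℚ
  check I S := (I.withBox S).check
  sound I S h := fun _ hy₀ => (HOEStepCert.sound (c := I.withBox S) h hy₀).1

end VerifierPackaging

/-! ### Moore's Volterra example, replayed by the kernel -/

section MooreExample

/-- Volterra's equations of conflicting populations with Moore's coefficients `a₁ = 2`, `a₂ = 1`:
`x₁' = 2x₁(1 − x₂) = 2x₁ − 2x₁x₂`, `x₂' = −x₂(1 − x₁) = −x₂ + x₁x₂`, as term lists.
[cite: Moore1979, §8.1 eq. (8.6)] -/
def volterraField : Fin 2 → QMvPoly :=
  ![[([1, 0], 2), ([1, 1], -2)], [([0, 1], -1), ([1, 1], 1)]]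

/-- Value of one term with an arbitrary real coefficient (as `QMvPoly.eval_monomial_mexp`, after
the coefficient cast has been simplified away). [folklore] -/
private theorem eval_monomial_mexp' {n : ℕ} (x : Fin n → ℝ) (m : List ℕ) (a : ℝ) :
    MvPolynomial.eval x (MvPolynomial.monomial (QMvPoly.mexp n m) a) =
      a * ∏ i, x i ^ m.getD i 0 := by
  rw [MvPolynomial.eval_monomial, Finsupp.prod_fintype _ _ (fun i => pow_zero _)]
  simp

/-- The term lists denote Moore's right-hand sides. [cite: Moore1979, §8.1 eq. (8.6)] -/
theorem eval_fieldMv_volterraField (x : Fin 2 → ℝ) :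
    evalVec (fieldMv volterraField) x = ![2 * x 0 * (1 - x 1), -(x 1 * (1 - x 0))] := by
  ext i
  fin_cases i
  · simp [fieldMv, volterraField, eval_monomial_mexp', Fin.prod_univ_two]
    ring
  · simp [fieldMv, volterraField, eval_monomial_mexp', Fin.prod_univ_two]
    ring

/-- **Moore's validated step** for (8.6): initial point `x(0) = (1, 3)` (degenerate boxes), the
a-priori box `B = [0, 4/3] × [2.5, 19/6]` of p. 81, step `h = 0.125`, order `N`.
[cite: Moore1979, §8.1 eqs. (8.6)–(8.8), (8.10)] -/
def mooreVolterra (N : ℕ) : HOEStepCert 2 where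
  field := volterraField
  order := N
  step := 1 / 8
  init := ![pure 1, pure 3]
  apriori := ![⟨(0, 4 / 3), by decide +kernel⟩, ⟨(5 / 2, 19 / 6), by decide +kernel⟩]

/-- The kernel accepts Moore's step at order `N = 9` (and the HOE test (8.10) ⊆ `B` holds).
[cite: Moore1979, §8.1 eq. (8.10) and the table on p. 82] -/
theorem mooreVolterra_check : (mooreVolterra 9).check = true := by
  decide +kernel

/-- The certified end box at order 9 is contained in `[0.60998, 0.61142] × [2.92126, 2.92192]`
(kernel computation; Moore's `N = 9` row for `x₂(0.125)`, obtained through the recursion (8.9)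
rather than the expanded natural extension, is the sub-box `[2.9215249, 2.9215965]`).
[cite: Moore1979, §8.1 table on p. 82] -/
theorem mooreVolterra_endBox_le :
    boxLE (mooreVolterra 9).endBox
      ![⟨(60998 / 100000, 61142 / 100000), by decide +kernel⟩,
        ⟨(292126 / 100000, 292192 / 100000), by decide +kernel⟩] = true := by
  decide +kernel

/-- The initial point `(1, 3)` lies in the (degenerate) initial box. [cite: Moore1979, §8.1 eq. (8.6)] -/
theorem mooreVolterra_init_mem : (![1, 3] : Fin 2 → ℝ) ∈ boxSet (castBox (mooreVolterra 9).init) := by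
  rw [mem_boxSet_iff]
  intro i
  fin_cases i
  · show (1 : ℝ) ∈ (pure (1 : ℚ)).ratCast ℝ
    rw [ratCast_pure, Rat.cast_one]; exact mem_pure_self _
  · show (3 : ℝ) ∈ (pure (3 : ℚ)).ratCast ℝ
    rw [ratCast_pure, Rat.cast_ofNat]; exact mem_pure_self _

/-- **Existence, certified by the kernel**: Volterra's system (8.6) with `x(0) = (1, 3)` has a
solution on `[0, 0.125]` (Moore obtains this from (8.7) with `c = 42/48 < 1`; here it is the
accepted HOE certificate). [cite: Moore1979, §8.1 eqs. (8.6)–(8.8)] -/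
theorem mooreVolterra_exists :
    ∃ y : ℝ → Fin 2 → ℝ, y 0 = ![1, 3] ∧ ∀ t ∈ Icc (0 : ℝ) (((1 / 8 : ℚ) : ℝ)),
      HasDerivWithinAt y (evalVec (fieldMv volterraField) (y t)) (Icc (0 : ℝ) ((1 / 8 : ℚ) : ℝ)) t :=
  (HOEStepCert.sound mooreVolterra_check mooreVolterra_init_mem).1

/-- **Enclosure, certified by the kernel**: every solution of (8.6) with `x(0) = (1, 3)` on
`[0, 0.125]` stays in `B = [0, 4/3] × [2.5, 19/6]` and ends in the certified end box; in
particular `x₂(0.125) ∈ [2.92126, 2.92192]`. [cite: Moore1979, §8.1 eq. (8.10) and the table on p. 82] -/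
theorem mooreVolterra_endpoint {z : ℝ → Fin 2 → ℝ} (hz0 : z 0 = ![1, 3])
    (hz : ∀ t ∈ Icc (0 : ℝ) (((1 / 8 : ℚ) : ℝ)),
      HasDerivWithinAt z (evalVec (fieldMv volterraField) (z t)) (Icc (0 : ℝ) ((1 / 8 : ℚ) : ℝ)) t) :
    (∀ t ∈ Icc (0 : ℝ) (((1 / 8 : ℚ) : ℝ)), z t ∈ boxSet (castBox (mooreVolterra 9).apriori)) ∧
      z ((1 / 8 : ℚ) : ℝ) ∈ boxSet (castBox (mooreVolterra 9).endBox) :=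
  ⟨fun t ht => ((HOEStepCert.sound mooreVolterra_check mooreVolterra_init_mem).2 z hz0 hz t ht).1,
    HOEStepCert.mem_endBox mooreVolterra_check mooreVolterra_init_mem hz0 hz⟩

end MooreExample

end Literature.Analysis.ODE
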